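import Summits.QuantumFields.YangMills.Theses.HyperbolicRegulator
import Summits.QuantumFields.YangMills.Theorems.HyperbolicRegulatorHyperbolicToTorusDefs
import Summits.QuantumFields.YangMills.Theorems.HyperbolicRegulatorCurvatureUniformityRLocalFar

/-!
# Route `HyperbolicRegulator`, crux `CurvatureUniformityR` (stmt-QuantumFields-18154): chart vocabulary of the line
# `single-chart-markov` (route-posited objects, D-0016 `<Route><Crux>Defs`-style file)

Lead prover `prover-line-stmt-QuantumFields-18154-0`, 2026-08-17 (skeleton `Cruxes/CurvatureUniformityR/Lines/Sketch.lean`, card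
`Cruxes/CurvatureUniformityR/Ideas/single-chart-markov.md`). NOTHING here is asserted about the route: this file NAMES, byte for
byte, the `let`-bound objects of the crux's shared vocabulary `let Fam := …` (so that every named object is definitionally equal
to the corresponding `let` of `Summit.QuantumFields.YangMills.Theses.HyperbolicRegulator.CurvatureUniformityR` once the same
variables are in scope), adds the `ℤ⁴` box / host-edge bookkeeping of ONE flat chart product box, and states (as `def … : Prop`)
the sub-goals of the line — the registered stubs prove exactly these names:

* §1 `AdmR` (repaired admissibility = `(Fam k j …).1`, `G`-free), `IsFlatR` (flat vertex, `k/2 < dist` to every cone),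
  `inBox2` / `nx2` (the chart box `ib` and step `nx`).
* §2 the product-complex gauge field: `PE` (edge set `(E ×ˢ V) ⊔ (V ×ˢ E)` of `S × S`), `linkVal` (= `v`), `plaqWeight r` (= `w`),
  `act r` (= `S`, the three square sorts), `haarPi` (= `ν`), `gibbsX r … β` (= `X`, the normalised Wilson expectation),
  `chartRead` (= `P x x'`, the chart-read `ℤ⁴` configuration) and its host-edge map `hostEdge`, `boxEdges4`, `hostSet`.
* §3 the line's propositions: `ChartInteriorStructure` (G-free chart combinatorics), `PlaquetteSumMatch` (the host action
  changes under resampling host links exactly as the `ℤ⁴` boundary Wilson sum read through the chart), `ChartTransfer`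
  (resampling host links = gluing fresh `ℤ⁴` links, in law), `ChartDLR` (the DLR identity of the family's Wilson state on a flat
  chart box, far factor included), `FamilyMeanInfluenceDecay` (the K-type leaf: mean oscillation of the box-kernel mean under
  the family's own state decays in the box radius, constants uniform in the curvature scale).
* §4 the crux's two halves NAMED: `Sp`, `ClustLocalR` / `ClustFarR` and the definitional unfoldings
  `curvatureUniformityLocalR_iff` / `curvatureUniformityFarR_iff` (`Iff.rfl`: the named vocabulary is byte-compatible with the
  inlined `let Fam := …` of `HyperbolicRegulatorCurvatureUniformityRLocalFar.lean`, hence with the crux).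

References: route file `Theses/HyperbolicRegulator.lean` (crux l.401–403); the torus twins
`Theorems/OneCertifiedCubeFiniteSizeCriterionTorus.lean` (`integral_torusLift_mul_eq_integral_ymSpecification_mul_of_measurable`)
and `Theorems/ConvexGribovBodyNonSimplyConnectedLatticeGapStubCruxOfMeanBoxInfluenceDecayNSC.lean` (`abs_cov_torus_le_meanBoxInfluence`,
mean-box-influence currency); Georgii, *Gibbs Measures and Phase Transitions* (2011) Prop. 2.5, §8.2; Seiler LNP 159 Ch. 2.
-/

set_option autoImplicit false

noncomputable section

namespace Summit.QuantumFields.YangMills.Cruxes.CurvatureUniformityR.SingleChartMarkov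

open MeasureTheory
open Literature.MathematicalPhysics.QuantumFieldTheory (LatticeRep YMSpecies haarProbability IsCompactSimpleLieGroup)
open Literature.MathematicalPhysics.QuantumLattice (ZdEdge LGConfig ymSpecification plaquettesTouching plaquetteObs)
open Literature.Probability.LatticeModels (Site glueWith)
open Summit.QuantumFields.YangMills.Cruxes.HyperbolicToTorus.NoAdmissibleComplex (graphOf degOf conesOf)

/-! ## §1 Admissibility (repaired) and flatness, named -/

/-- **Repaired admissibility** of one finite square complex at curvature scale `k` and separation index `j` — VERBATIM the
first component `(Fam k j V E Q σ τ bd cV cE).1` of the crux's inlined vocabulary (byte for byte the hypothesis of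
`ConeTameSplit.ConeChartsOfAdmissible`): graph/square axioms, degrees 4 or 5 with #squares = degree, every edge in two
squares, cones `k`-dense and `k`-separated, Poincaré inequality `10⁶k²`, two deep points (`3(k/4) < dist` to every cone) at
distance `≥ j`, injective flat `ℤ²`-charts of sup-radius `k/4` at every vertex farther than `k/2` from all cones. `G`-free. -/
def AdmR (k j : ℕ) (V E Q : Finset ℕ) (σ τ : ℕ → ℕ) (bd : ℕ → Fin 4 → ℕ × Bool) (cV : ℕ → ℤ × ℤ → ℕ)
    (cE : ℕ → ℤ × ℤ → Fin 2 → ℕ × Bool) : Prop :=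
  let st := fun e : ℕ × Bool => if e.2 then σ e.1 else τ e.1; let en := fun e : ℕ × Bool => if e.2 then τ e.1 else σ e.1; let Γ := SimpleGraph.fromRel fun a b : ℕ => ∃ e ∈ E, σ e = a ∧ τ e = b; let dg := fun x : ℕ => (E.filter fun e => σ e = x ∨ τ e = x).card; let K := V.filter fun x => dg x = 5; let F := fun x : ℕ => x ∈ V ∧ ∀ c ∈ K, k / 2 < Γ.dist x c; let Dp := fun x : ℕ => x ∈ V ∧ ∀ c ∈ K, 3 * (k / 4) < Γ.dist x c; let ib := fun a : ℤ × ℤ => |a.1| ≤ (k : ℤ) / 4 ∧ |a.2| ≤ (k : ℤ) / 4; let nx := fun (a : ℤ × ℤ) (μ : Fin 2) => if μ = 0 then (a.1 + 1, a.2) else (a.1, a.2 + 1); (∀ e ∈ E, σ e ∈ V ∧ τ e ∈ V ∧ σ e ≠ τ e) ∧ (∀ q ∈ Q, (∀ i, (bd q i).1 ∈ E) ∧ (∀ i, en (bd q i) = st (bd q (i + 1))) ∧ (st ∘ bd q).Injective) ∧ (∀ e ∈ E, (Q.filter fun q => ∃ i, (bd q i).1 = e).card = 2) ∧ (∀ x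 ∈ V, (dg x = 4 ∨ dg x = 5) ∧ (Q.filter fun q => ∃ i, st (bd q i) = x).card = dg x) ∧ (∀ x ∈ V, ∃ c ∈ K, Γ.dist x c ≤ k) ∧ (∀ c ∈ K, ∀ c' ∈ K, c ≠ c' → k ≤ Γ.dist c c') ∧ (∀ f : ℕ → ℝ, ∑ x ∈ V, f x = 0 → ∑ x ∈ V, f x ^ 2 ≤ 10 ^ 6 * (k : ℝ) ^ 2 * ∑ e ∈ E, (f (σ e) - f (τ e)) ^ 2) ∧ (∃ x y, Dp x ∧ Dp y ∧ j ≤ Γ.dist x y) ∧ (∀ x, F x → cV x (0, 0) = x ∧ (∀ a, ib a → cV x a ∈ V) ∧ Set.InjOn (cV x) {a | ib a} ∧ (∀ a μ, ib a → ib (nx a μ) → (cE x a μ).1 ∈ E ∧ st (cE x a μ) = cV x a ∧ en (cE x a μ) = cV x (nx a μ)) ∧ (∀ a, ib a → ib (a.1 + 1, a.2 + 1) → ∃ q ∈ Q, Finset.univ.image (Prod.fst ∘ bd q) = {(cE x a 0).1, (cE x (nx a 0) 1).1, (cE x (nx a 1) 0).1, (cE x a 1).1}))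

/-- **Flat vertex** (the crux's `let F`): `x ∈ V` farther than `k/2` from every cone (degree-5 vertex). -/
def IsFlatR (k : ℕ) (V E : Finset ℕ) (σ τ : ℕ → ℕ) (x : ℕ) : Prop :=
  x ∈ V ∧ ∀ c ∈ conesOf V E σ τ, k / 2 < (graphOf E σ τ).dist x c

/-- The chart box (the crux's `let ib`): `|a.1|, |a.2| ≤ (k:ℤ)/4`. -/
def inBox2 (k : ℕ) (a : ℤ × ℤ) : Prop := |a.1| ≤ (k : ℤ) / 4 ∧ |a.2| ≤ (k : ℤ) / 4

/-- The chart step (the crux's `let nx`): `nx a 0 = a + e₁`, `nx a 1 = a + e₂`. -/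
def nx2 (a : ℤ × ℤ) (μ : Fin 2) : ℤ × ℤ := if μ = 0 then (a.1 + 1, a.2) else (a.1, a.2 + 1)

/-! ## §2 The gauge field on the product complex `S × S`, named -/

/-- The oriented edge set of `S × S` (the crux's `let PE`): horizontal edges `E × V` and vertical edges `V × E`. -/
def PE (V E : Finset ℕ) : Finset ((ℕ × ℕ) ⊕ (ℕ × ℕ)) := (E ×ˢ V).disjSum (V ×ˢ E)

section Field

variable {G : Type} [Group G]

/-- The link variable read with an orientation flag (the crux's `let v`): `U e` or `(U e)⁻¹`, junk `1` off `PE`. -/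
def linkVal {V E : Finset ℕ} (U : ↥(PE V E) → G) (e : ((ℕ × ℕ) ⊕ (ℕ × ℕ)) × Bool) : G :=
  if h : e.1 ∈ PE V E then (if e.2 then U ⟨e.1, h⟩ else (U ⟨e.1, h⟩)⁻¹) else 1

/-- The host edge of `S × S` (with orientation flag) read by the chart product at base points `(x, x')` at the `ℤ⁴` edge
`p`: directions `0, 1` are horizontal (first factor's edge chart `cE x`, second factor's vertex chart `cV x'`), directions
`2, 3` vertical. -/
def hostEdge (cV : ℕ → ℤ × ℤ → ℕ) (cE : ℕ → ℤ × ℤ → Fin 2 → ℕ × Bool) (x x' : ℕ) (p : ZdEdge 4) :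
    ((ℕ × ℕ) ⊕ (ℕ × ℕ)) × Bool :=
  let d0 : Fin 4 → Fin 2 := ![0, 1, 0, 1]
  let a := (p.1 0, p.1 1); let b := (p.1 2, p.1 3)
  if p.2 = 0 ∨ p.2 = 1 then (Sum.inl ((cE x a (d0 p.2)).1, cV x' b), (cE x a (d0 p.2)).2)
  else (Sum.inr (cV x a, (cE x' b (d0 p.2)).1), (cE x' b (d0 p.2)).2)

/-- The chart-read `ℤ⁴` configuration at base points `(x, x')` (the crux's `let P x x'`, with `let d0 := ![0, 1, 0, 1]`). -/
def chartRead {V E : Finset ℕ} (cV : ℕ → ℤ × ℤ → ℕ) (cE : ℕ → ℤ × ℤ → Fin 2 → ℕ × Bool) (x x' : ℕ)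
    (U : ↥(PE V E) → G) : LGConfig 4 G :=
  let d0 : Fin 4 → Fin 2 := ![0, 1, 0, 1]
  fun p : ZdEdge 4 => let a := (p.1 0, p.1 1); let b := (p.1 2, p.1 3); if p.2 = 0 ∨ p.2 = 1 then linkVal U (Sum.inl ((cE x a (d0 p.2)).1, cV x' b), (cE x a (d0 p.2)).2) else linkVal U (Sum.inr (cV x a, (cE x' b (d0 p.2)).1), (cE x' b (d0 p.2)).2)

/-- `chartRead` reads the link at the host edge. -/
theorem chartRead_apply {V E : Finset ℕ} (cV : ℕ → ℤ × ℤ → ℕ) (cE : ℕ → ℤ × ℤ → Fin 2 → ℕ × Bool)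
    (x x' : ℕ) (U : ↥(PE V E) → G) (p : ZdEdge 4) :
    chartRead cV cE x x' U p = linkVal U (hostEdge cV cE x x' p) := by
  unfold chartRead hostEdge
  dsimp only
  split_ifs <;> rfl


variable [TopologicalSpace G]

/-- The plaquette weight of a flagged boundary word (the crux's `let w`): `Re tr r.ρ (v₀ v₁ v₂ v₃)`. -/
def plaqWeight (r : LatticeRep G) {V E : Finset ℕ} (U : ↥(PE V E) → G)
    (e : Fin 4 → ((ℕ × ℕ) ⊕ (ℕ × ℕ)) × Bool) : ℝ :=
  (r.ρ (linkVal U (e 0) * linkVal U (e 1) * linkVal U (e 2) * linkVal U (e 3))).trace.re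

/-- Wilson's action on `S × S` (the crux's `let S`): the three square sorts face × vertex, vertex × face, edge × edge. -/
def act (r : LatticeRep G) (V E Q : Finset ℕ) (σ τ : ℕ → ℕ) (bd : ℕ → Fin 4 → ℕ × Bool)
    (U : ↥(PE V E) → G) : ℝ :=
  (∑ q ∈ Q, ∑ y ∈ V, plaqWeight r U fun i => (Sum.inl ((bd q i).1, y), (bd q i).2)) +
    (∑ y ∈ V, ∑ q ∈ Q, plaqWeight r U fun i => (Sum.inr (y, (bd q i).1), (bd q i).2)) +
      ∑ e ∈ E, ∑ e' ∈ E, plaqWeight r U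
        ![(Sum.inl (e, σ e'), true), (Sum.inr (τ e, e'), true), (Sum.inl (e, τ e'), false), (Sum.inr (σ e, e'), false)]

variable [IsTopologicalGroup G] [CompactSpace G] [MeasurableSpace G] [BorelSpace G]

/-- Product Haar measure on the links of `S × S` (the crux's `let ν`). -/
def haarPi (V E : Finset ℕ) : Measure (↥(PE V E) → G) := Measure.pi fun _ : ↥(PE V E) => haarProbability G

/-- The normalised Wilson expectation at coupling `β` (the crux's `let X`). -/
def gibbsX (r : LatticeRep G) (V E Q : Finset ℕ) (σ τ : ℕ → ℕ) (bd : ℕ → Fin 4 → ℕ × Bool) (β : ℝ)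
    (f : (↥(PE V E) → G) → ℝ) : ℝ :=
  (∫ U, f U * Real.exp (β * act r V E Q σ τ bd U) ∂haarPi V E) /
    ∫ U, Real.exp (β * act r V E Q σ τ bd U) ∂haarPi V E

end Field

/-- The `ℤ⁴` edges of the sup-box of radius `R`: base point and end point both in `[-R, R]⁴`. -/
def boxEdges4 (R : ℕ) : Finset (ZdEdge 4) :=
  ((Fintype.piFinset fun _ : Fin 4 => Finset.Icc (-(R : ℤ)) R) ×ˢ (Finset.univ : Finset (Fin 4))).filter
    fun e => e.1 e.2 + 1 ≤ (R : ℤ)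

/-- The host links (as links of `S × S`) read by the chart product `(x, x')` on the `ℤ⁴` edge set `Λ`. -/
def hostSet (V E : Finset ℕ) (cV : ℕ → ℤ × ℤ → ℕ) (cE : ℕ → ℤ × ℤ → Fin 2 → ℕ × Bool) (x x' : ℕ)
    (Λ : Finset (ZdEdge 4)) : Finset ↥(PE V E) :=
  Finset.univ.filter fun e => ∃ p ∈ Λ, (hostEdge cV cE x x' p).1 = (e : (ℕ × ℕ) ⊕ (ℕ × ℕ))

/-! ## §3 The line's propositions -/

/-- **Chart interior structure** (G-free combinatorics of an admissible complex around a flat base point `x`, chart of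
sup-radius `R = k/4`). (E0) chart edge ids are injective on the box: equal ids force equal grid edges; (E1) at an interior
grid point `a` (`|a.1|, |a.2| ≤ R − 1`) the edges of `E` at `cV x a` are exactly the four chart edges; (E2) a square of `Q`
through an interior chart edge `cE x a μ` (both flanking unit grid squares inside the box) has the edge-id set of one of the
two flanking chart squares. (Elementary combinatorics of square complexes; the tree's `card_edgesAt_ne_five_of_boxChart` is the
degree half of (E1).) -/
def ChartInteriorStructure : Prop :=
  ∀ (k j : ℕ) (V E Q : Finset ℕ) (σ τ : ℕ → ℕ) (bd : ℕ → Fin 4 → ℕ × Bool) (cV : ℕ → ℤ × ℤ → ℕ)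
    (cE : ℕ → ℤ × ℤ → Fin 2 → ℕ × Bool), 8 ≤ k → AdmR k j V E Q σ τ bd cV cE →
    ∀ x : ℕ, IsFlatR k V E σ τ x →
      (∀ (a a' : ℤ × ℤ) (μ μ' : Fin 2), inBox2 k a → inBox2 k (nx2 a μ) → inBox2 k a' → inBox2 k (nx2 a' μ') →
          (cE x a μ).1 = (cE x a' μ').1 → a = a' ∧ μ = μ') ∧
      (∀ a : ℤ × ℤ, |a.1| ≤ (k : ℤ) / 4 - 1 → |a.2| ≤ (k : ℤ) / 4 - 1 →
          E.filter (fun e => σ e = cV x a ∨ τ e = cV x a) =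
            {(cE x a 0).1, (cE x a 1).1, (cE x (a.1 - 1, a.2) 0).1, (cE x (a.1, a.2 - 1) 1).1}) ∧
      (∀ (a : ℤ × ℤ) (μ : Fin 2), inBox2 k a → inBox2 k (nx2 a μ) →
          inBox2 k (nx2 (nx2 a μ) (1 - μ)) → inBox2 k (if μ = 0 then (a.1, a.2 - 1) else (a.1 - 1, a.2)) →
          ∀ q ∈ Q, (∃ i, (bd q i).1 = (cE x a μ).1) →
            Finset.univ.image (Prod.fst ∘ bd q) =
                {(cE x a 0).1, (cE x (nx2 a 0) 1).1, (cE x (nx2 a 1) 0).1, (cE x a 1).1} ∨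
              Finset.univ.image (Prod.fst ∘ bd q) =
                (let a' : ℤ × ℤ := if μ = 0 then (a.1, a.2 - 1) else (a.1 - 1, a.2)
                 {(cE x a' 0).1, (cE x (nx2 a' 0) 1).1, (cE x (nx2 a' 1) 0).1, (cE x a' 1).1}))

section Props

/-- **Plaquette sum match.** For an admissible complex, flat base points `(x, x')` and a `ℤ⁴` edge set `Λ` inside the box of
sup-radius `k/4 − 1`, resampling the host links of `Λ` changes Wilson's action on `S × S` exactly as it changes the sum of
the `ℤ⁴` plaquette observables over the plaquettes touching `Λ`, read through the chart: the host squares meeting the host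
links are the chart images of those `ℤ⁴` plaquettes (three sorts ↔ planes `01` / `23` / mixed), with equal weights (trace
cyclicity and `Re tr ρ(g⁻¹) = Re tr ρ(g)` for unitary `ρ` absorb the starting corner and orientation of each boundary word). -/
def PlaquetteSumMatch : Prop :=
  ∀ (G : Type) [Group G] [TopologicalSpace G] (r : LatticeRep G) (k j : ℕ) (V E Q : Finset ℕ) (σ τ : ℕ → ℕ)
    (bd : ℕ → Fin 4 → ℕ × Bool) (cV : ℕ → ℤ × ℤ → ℕ) (cE : ℕ → ℤ × ℤ → Fin 2 → ℕ × Bool),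
    8 ≤ k → AdmR k j V E Q σ τ bd cV cE → ∀ x x' : ℕ, IsFlatR k V E σ τ x → IsFlatR k V E σ τ x' →
    ∀ Λ : Finset (ZdEdge 4), Λ ⊆ boxEdges4 (k / 4 - 1) →
    ∀ (U W : ↥(PE V E) → G),
      act r V E Q σ τ bd ((hostSet V E cV cE x x' Λ).piecewise W U) - act r V E Q σ τ bd U =
        ∑ p ∈ plaquettesTouching Λ,
          (plaquetteObs r.ρ p.1 p.2.1.1 p.2.1.2 (chartRead cV cE x x' ((hostSet V E cV cE x x' Λ).piecewise W U)) -
            plaquetteObs r.ρ p.1 p.2.1.1 p.2.1.2 (chartRead cV cE x x' U))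

/-- **Chart transfer.** For an admissible complex, flat `(x, x')` and `Λ` inside the box of sup-radius `k/4`: gluing fresh
Haar links on `Λ` into the chart-read configuration has the same law as reading the chart after resampling the host links of
`Λ` (the host-edge map is injective on the box, and Haar measure is inversion invariant), tested on measurable functions of
the box links. -/
def ChartTransfer : Prop :=
  ∀ (G : Type) [Group G] [TopologicalSpace G] [IsTopologicalGroup G] [CompactSpace G] [MeasurableSpace G]
    [BorelSpace G] (k j : ℕ) (V E Q : Finset ℕ) (σ τ : ℕ → ℕ) (bd : ℕ → Fin 4 → ℕ × Bool)
    (cV : ℕ → ℤ × ℤ → ℕ) (cE : ℕ → ℤ × ℤ → Fin 2 → ℕ × Bool),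
    8 ≤ k → AdmR k j V E Q σ τ bd cV cE → ∀ x x' : ℕ, IsFlatR k V E σ τ x → IsFlatR k V E σ τ x' →
    ∀ Λ : Finset (ZdEdge 4), Λ ⊆ boxEdges4 (k / 4) →
    ∀ Φ : LGConfig 4 G → ℝ, Measurable Φ → DependsOn Φ ↑(boxEdges4 (k / 4)) →
    ∀ U : ↥(PE V E) → G,
      ∫ ζ, Φ (glueWith Λ ζ (chartRead cV cE x x' U)) ∂(Measure.pi fun _ : ↥Λ => haarProbability G) =
        ∫ W, Φ (chartRead cV cE x x' ((hostSet V E cV cE x x' Λ).piecewise W U)) ∂(haarPi (G := G) V E)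

/-- **ChartDLR — the DLR identity of the family's Wilson state on a flat chart box, far factor included.** For an admissible
complex, coupling `β`, flat base points `(x, x')`, a `ℤ⁴` edge set `Λ` inside the box of sup-radius `k/4 − 1`, a bounded
measurable `f` depending only on the box links (sup-radius `k/4`) and a bounded measurable far factor `H` blind to the host
links of `Λ`: `X(f∘P · H) = X((γ_Λ f)∘P · H)`, `γ = ymSpecification r.ρ β` read through the chart. (Hyperbolic twin of the
landed torus identity `FiniteSizeCriterion.integral_torusLift_mul_eq_integral_ymSpecification_mul_of_measurable`; Georgii 2011
Prop. 2.5 / Thm. 4.17.) -/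
def ChartDLR : Prop :=
  ∀ (G : Type) [Group G] [TopologicalSpace G] [IsTopologicalGroup G] [CompactSpace G] [MeasurableSpace G]
    [BorelSpace G] (r : LatticeRep G) (k j : ℕ) (V E Q : Finset ℕ) (σ τ : ℕ → ℕ) (bd : ℕ → Fin 4 → ℕ × Bool)
    (cV : ℕ → ℤ × ℤ → ℕ) (cE : ℕ → ℤ × ℤ → Fin 2 → ℕ × Bool),
    8 ≤ k → AdmR k j V E Q σ τ bd cV cE → ∀ (β : ℝ) (x x' : ℕ), IsFlatR k V E σ τ x → IsFlatR k V E σ τ x' →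
    ∀ Λ : Finset (ZdEdge 4), Λ ⊆ boxEdges4 (k / 4 - 1) →
    ∀ f : LGConfig 4 G → ℝ, Measurable f → (∃ C, ∀ U, |f U| ≤ C) → DependsOn f ↑(boxEdges4 (k / 4)) →
    ∀ H : (↥(PE V E) → G) → ℝ, Measurable H → (∃ C, ∀ U, |H U| ≤ C) →
      (∀ W U, H ((hostSet V E cV cE x x' Λ).piecewise W U) = H U) →
      gibbsX r V E Q σ τ bd β (fun U => f (chartRead cV cE x x' U) * H U) =
        gibbsX r V E Q σ τ bd β (fun U =>
          (∫ W, f W ∂(ymSpecification r.ρ β Λ (chartRead cV cE x x' U))) * H U)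

/-- **Family mean influence decay — the line's K-type leaf (weak-coupling mixing, MEAN currency, on the family).** For every
compact simple `G` and faithful unitary `r` there is `β₁` such that for every `β ≥ β₁` ONE rate `m > 0` serves: for every
species `A` there are a constant `C` and a scale threshold `K₀` such that for every admissible complex at scale `k ≥ K₀`,
every pair of flat base points `(x, x')` and every box radius `L ≤ k/4 − 1` with `A.supp ⊆ boxEdges4 L`, the kernel mean
`γ_{box L}(A)` read through the chart oscillates around the state mean of `A∘P` by at most `C e^{−m L}` IN MEAN under the
family's own Wilson state. Contains the weak-coupling volume-uniform gap (false for `U(1)`); it follows from flat box-influence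
decay in sup currency (simply-connected `G`) and, for all `G`, from good-set influence decay plus rarity of long bad chains in
chart boxes under the family's states (card `single-chart-markov`, findings (2)–(3)); twin of the sibling currency
`MeanBoxInfluenceDecayAt` of route `ConvexGribovBody` / crux `NonSimplyConnectedLatticeGap`. -/
def FamilyMeanInfluenceDecay : Prop :=
  ∀ (G : Type) [Group G] [TopologicalSpace G] [IsTopologicalGroup G] [CompactSpace G] [MeasurableSpace G]
    [BorelSpace G], IsCompactSimpleLieGroup G →
    ∀ r : LatticeRep G, ∃ β₁ : ℝ, ∀ β : ℝ, β₁ ≤ β → ∃ m : ℝ, 0 < m ∧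
      ∀ A : YMSpecies G, ∃ C : ℝ, ∃ K₀ : ℕ,
        ∀ (k j : ℕ) (V E Q : Finset ℕ) (σ τ : ℕ → ℕ) (bd : ℕ → Fin 4 → ℕ × Bool) (cV : ℕ → ℤ × ℤ → ℕ)
          (cE : ℕ → ℤ × ℤ → Fin 2 → ℕ × Bool), K₀ ≤ k → AdmR k j V E Q σ τ bd cV cE →
        ∀ x x' : ℕ, IsFlatR k V E σ τ x → IsFlatR k V E σ τ x' →
        ∀ L : ℕ, (L : ℤ) ≤ (k : ℤ) / 4 - 1 → A.supp ⊆ boxEdges4 L →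
          gibbsX r V E Q σ τ bd β (fun U =>
              |(∫ W, A.F W ∂(ymSpecification r.ρ β (boxEdges4 L) (chartRead cV cE x x' U))) -
                gibbsX r V E Q σ τ bd β (fun U' => A.F (chartRead cV cE x x' U'))|) ≤
            C * Real.exp (-(m * L))

end Props


/-! ## §4 The crux's halves LOCAL / FAR in the named vocabulary (definitional unfoldings) -/

section Named

variable {G : Type} [Group G] [TopologicalSpace G] [IsTopologicalGroup G] [CompactSpace G] [MeasurableSpace G]
  [BorelSpace G]

omit [IsTopologicalGroup G] [CompactSpace G] [BorelSpace G] in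
/-- Support radius of a species (the crux's `let Sp`). -/
def Sp (A : YMSpecies G) (R : ℕ) : Prop := ∀ p ∈ A.supp, ∀ i, |p.1 i| ≤ (R : ℤ)

/-- **Single-chart clustering predicate** at `(β, m, C, A, B)` on one complex: LOCAL's clustering table entry, named —
flat base points, product distance `≤ k/16`, covariance of the chart-read species under `gibbsX` bounded by
`C e^{-m (dist x y + dist x' y')}`. -/
def ClustLocalR (r : LatticeRep G) (k : ℕ) (V E Q : Finset ℕ) (σ τ : ℕ → ℕ) (bd : ℕ → Fin 4 → ℕ × Bool)
    (cV : ℕ → ℤ × ℤ → ℕ) (cE : ℕ → ℤ × ℤ → Fin 2 → ℕ × Bool) (β m C : ℝ) (A B : YMSpecies G) : Prop :=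
  ∀ x x' y y', IsFlatR k V E σ τ x → IsFlatR k V E σ τ x' → IsFlatR k V E σ τ y → IsFlatR k V E σ τ y' →
    (graphOf E σ τ).dist x y + (graphOf E σ τ).dist x' y' ≤ k / 16 →
    |gibbsX r V E Q σ τ bd β (fun U => A.F (chartRead cV cE x x' U) * B.F (chartRead cV cE y y' U)) -
        gibbsX r V E Q σ τ bd β (fun U => A.F (chartRead cV cE x x' U)) *
          gibbsX r V E Q σ τ bd β (fun U => B.F (chartRead cV cE y y' U))| ≤
      C * Real.exp (-(m * (((graphOf E σ τ).dist x y + (graphOf E σ τ).dist x' y' : ℕ) : ℝ)))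

/-- **Far clustering predicate** at `(β, m, C, A, B)`: FAR's clustering table entry, named (product distance `> k/16`). -/
def ClustFarR (r : LatticeRep G) (k : ℕ) (V E Q : Finset ℕ) (σ τ : ℕ → ℕ) (bd : ℕ → Fin 4 → ℕ × Bool)
    (cV : ℕ → ℤ × ℤ → ℕ) (cE : ℕ → ℤ × ℤ → Fin 2 → ℕ × Bool) (β m C : ℝ) (A B : YMSpecies G) : Prop :=
  ∀ x x' y y', IsFlatR k V E σ τ x → IsFlatR k V E σ τ x' → IsFlatR k V E σ τ y → IsFlatR k V E σ τ y' →
    k / 16 < (graphOf E σ τ).dist x y + (graphOf E σ τ).dist x' y' →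
    |gibbsX r V E Q σ τ bd β (fun U => A.F (chartRead cV cE x x' U) * B.F (chartRead cV cE y y' U)) -
        gibbsX r V E Q σ τ bd β (fun U => A.F (chartRead cV cE x x' U)) *
          gibbsX r V E Q σ τ bd β (fun U => B.F (chartRead cV cE y y' U))| ≤
      C * Real.exp (-(m * (((graphOf E σ τ).dist x y + (graphOf E σ τ).dist x' y' : ℕ) : ℝ)))

end Named

/-- **LOCAL unfolded into the named vocabulary** (`Iff.rfl`): admissibility `AdmR`, support radius `Sp`, clustering entries
`ClustLocalR` (flatness `IsFlatR`, graph `graphOf`, expectation `gibbsX`, chart read-out `chartRead`). Provers of LOCAL prove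
the right-hand side. -/
theorem curvatureUniformityLocalR_iff : CurvatureUniformityLocalR ↔
    ∀ (G : Type) [Group G] [TopologicalSpace G] [IsTopologicalGroup G] [CompactSpace G], IsCompactSimpleLieGroup G →
      letI : MeasurableSpace G := borel G; haveI : BorelSpace G := ⟨rfl⟩; ∀ r : LatticeRep G,
      ∀ (V E Q : ℕ → ℕ → Finset ℕ) (σ τ : ℕ → ℕ → ℕ → ℕ) (bd : ℕ → ℕ → ℕ → Fin 4 → ℕ × Bool)
        (cV : ℕ → ℕ → ℕ → ℤ × ℤ → ℕ) (cE : ℕ → ℕ → ℕ → ℤ × ℤ → Fin 2 → ℕ × Bool),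
      (∀ k j, 8 ≤ k → AdmR k j (V k j) (E k j) (Q k j) (σ k j) (τ k j) (bd k j) (cV k j) (cE k j)) →
      (∃ c : ℝ, 0 < c ∧ ∀ k, 8 ≤ k → ∃ β₀ : ℝ, ∀ β, β₀ ≤ β → ∀ A B : YMSpecies G, Sp A (k / 8) → Sp B (k / 8) →
        ∃ C j₀, ∀ j, j₀ ≤ j →
          ClustLocalR r k (V k j) (E k j) (Q k j) (σ k j) (τ k j) (bd k j) (cV k j) (cE k j) β (c / k) C A B) →
      (∃ β₁ : ℝ, ∀ β, β₁ ≤ β → ∃ m : ℝ, 0 < m ∧ ∀ A B : YMSpecies G, ∃ C : ℝ, ∃ K : ℕ, ∀ k, K ≤ k →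
        Sp A (k / 8) → Sp B (k / 8) → ∃ j₀ : ℕ, ∀ j, j₀ ≤ j →
          ClustLocalR r k (V k j) (E k j) (Q k j) (σ k j) (τ k j) (bd k j) (cV k j) (cE k j) β m C A B) :=
  Iff.rfl

/-- **FAR unfolded into the named vocabulary** (`Iff.rfl`). -/
theorem curvatureUniformityFarR_iff : CurvatureUniformityFarR ↔
    ∀ (G : Type) [Group G] [TopologicalSpace G] [IsTopologicalGroup G] [CompactSpace G], IsCompactSimpleLieGroup G →
      letI : MeasurableSpace G := borel G; haveI : BorelSpace G := ⟨rfl⟩; ∀ r : LatticeRep G,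
      ∀ (V E Q : ℕ → ℕ → Finset ℕ) (σ τ : ℕ → ℕ → ℕ → ℕ) (bd : ℕ → ℕ → ℕ → Fin 4 → ℕ × Bool)
        (cV : ℕ → ℕ → ℕ → ℤ × ℤ → ℕ) (cE : ℕ → ℕ → ℕ → ℤ × ℤ → Fin 2 → ℕ × Bool),
      (∀ k j, 8 ≤ k → AdmR k j (V k j) (E k j) (Q k j) (σ k j) (τ k j) (bd k j) (cV k j) (cE k j)) →
      (∃ c : ℝ, 0 < c ∧ ∀ k, 8 ≤ k → ∃ β₀ : ℝ, ∀ β, β₀ ≤ β → ∀ A B : YMSpecies G, Sp A (k / 8) → Sp B (k / 8) →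
        ∃ C j₀, ∀ j, j₀ ≤ j →
          ClustFarR r k (V k j) (E k j) (Q k j) (σ k j) (τ k j) (bd k j) (cV k j) (cE k j) β (c / k) C A B) →
      (∃ β₁ : ℝ, ∀ β, β₁ ≤ β → ∃ m : ℝ, 0 < m ∧ ∀ A B : YMSpecies G, ∃ C : ℝ, ∃ K : ℕ, ∀ k, K ≤ k →
        Sp A (k / 8) → Sp B (k / 8) → ∃ j₀ : ℕ, ∀ j, j₀ ≤ j →
          ClustFarR r k (V k j) (E k j) (Q k j) (σ k j) (τ k j) (bd k j) (cV k j) (cE k j) β m C A B) :=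
  Iff.rfl

end Summit.QuantumFields.YangMills.Cruxes.CurvatureUniformityR.SingleChartMarkov

end
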